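import Mathlib
import HarnessLib
import Literature.MathematicalPhysics.QuantumLattice.KohnLuttinger
import Literature.MathematicalPhysics.QuantumLattice.KohnLuttingerChannelStates
import Summits.HubbardSuperconductivity.HubbardSuperconductivity.Theorems.ChiralWindowCwKLChiralWindowD4Invariant
import Summits.HubbardSuperconductivity.HubbardSuperconductivity.Theorems.ChiralWindowCwKLChiralWindowGradient
import Summits.HubbardSuperconductivity.HubbardSuperconductivity.Theorems.ChiralWindowCwKLChiralWindowLindhardD4
import Summits.HubbardSuperconductivity.HubbardSuperconductivity.Theorems.CwKLChiralWindow.Negative.ChannelStructure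

/-!
# `stub_klRotPartner`: the rotate of an `E` channel state

For the nearest-neighbour band `ε₀ = squareDispersion 1 0` and `μ ∈ (-4, 0)` the quarter turn
`rot = rotMomentum` is a measure-preserving measurable embedding of `(Momentum, σ_μ)`,
`σ_μ = fermiCurveMeasure ε₀ μ` (`kl_d4_rot_measurePreserving` + `stub_klGradient`, and
`kl_ld4_rot_measurePreserving.2`), so `∫ g ∘ rot dσ = ∫ g dσ` for every `g` with no integrability
hypothesis.  Consequences for an `E` channel state `f` (the `E` channel is the odd functions,
`inChannel_E_iff_odd`):

* `f ∘ rot` is again an `E` channel state (`rot (-k) = -rot k`; `MemLp` and the normalisation are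
  transported along `rot`);
* if `χ₀ ∘ rot = χ₀` then `Γ(rot k, rot k') = Γ(k, k')` (`rot` is additive), hence
  `pairingForm (f ∘ rot) = pairingForm f` for every `U` (substitute in both integrals);
* `∫ f (f ∘ rot) dσ = ∫ (f ∘ rot) (f ∘ rot²) dσ = -∫ (f ∘ rot) f dσ` (`rot² = -id`:
  `CwKLChiralWindow.Negative.rot_rot`; `f` odd), so `f ⊥ f ∘ rot`.
-/

noncomputable section

set_option linter.dupNamespace false

namespace Summit.HubbardSuperconductivity.HubbardSuperconductivity.Theorems

open MeasureTheory Literature.MathematicalPhysics.QuantumLattice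

/-! ### The quarter turn -/

/-- `rot (-k) = -rot k`. [folklore] -/
theorem kl_rp_rot_neg (k : Momentum) : rotMomentum (-k) = -rotMomentum k := by
  ext i
  fin_cases i <;> simp

/-- For `μ ∈ (-4, 0)` the quarter turn is a measure-preserving measurable embedding of
`(Momentum, σ_μ)` into itself, so `∫ g ∘ rot dσ_μ = ∫ g dσ_μ` for every `g` (no integrability
needed). [folklore] -/
theorem kl_rp_integral_comp_rot {μ : ℝ} (hμ : μ ∈ Set.Ioo (-4 : ℝ) 0) (g : Momentum → ℝ) :
    ∫ k, g (rotMomentum k) ∂fermiCurveMeasure (squareDispersion 1 0) μ =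
      ∫ k, g k ∂fermiCurveMeasure (squareDispersion 1 0) μ :=
  (kl_d4_rot_measurePreserving stub_klGradient hμ.2).integral_comp
    kl_ld4_rot_measurePreserving.2 g

/-! ### The `E` channel is `rot`-stable -/

/-- The rotate of an odd gap function is odd: `E` is stable under `f ↦ f ∘ rot`. [folklore] -/
theorem kl_rp_inChannel_E_comp_rot {f : Momentum → ℝ} (hf : InChannel .E f) :
    InChannel .E (f ∘ rotMomentum) := by
  rw [inChannel_E_iff_odd] at hf ⊢
  intro k
  simp only [Function.comp_apply, kl_rp_rot_neg, hf]

/-- For `μ ∈ (-4, 0)` the rotate of an `E` channel state is an `E` channel state. [folklore] -/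
theorem kl_rp_isChannelState_comp_rot {μ : ℝ} (hμ : μ ∈ Set.Ioo (-4 : ℝ) 0) {f : Momentum → ℝ}
    (hf : IsChannelState (squareDispersion 1 0) μ D4Irrep.E f) :
    IsChannelState (squareDispersion 1 0) μ D4Irrep.E (f ∘ rotMomentum) := by
  refine ⟨hf.1.comp_measurePreserving (kl_d4_rot_measurePreserving stub_klGradient hμ.2), ?_,
    kl_rp_inChannel_E_comp_rot hf.2.2⟩
  have h : ∫ k, f (rotMomentum k) ^ 2 ∂fermiCurveMeasure (squareDispersion 1 0) μ =
      ∫ k, f k ^ 2 ∂fermiCurveMeasure (squareDispersion 1 0) μ :=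
    kl_rp_integral_comp_rot hμ (fun k => f k ^ 2)
  rw [hf.2.1] at h
  exact h

/-! ### Invariance of the pairing form -/

/-- If `χ₀ ∘ rot = χ₀` then the Kohn–Luttinger kernel is `rot`-invariant:
`Γ(rot k, rot k') = Γ(k, k')` (`rot` is additive). [folklore] -/
theorem kl_rp_kernel_rot
    (hχ : ∀ (μ : ℝ) (q : Momentum),
      lindhardFunction (squareDispersion 1 0) μ (rotMomentum q) = lindhardFunction (squareDispersion 1 0) μ q)
    (μ U : ℝ) (k k' : Momentum) :
    kohnLuttingerKernel (squareDispersion 1 0) μ U (rotMomentum k) (rotMomentum k') =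
      kohnLuttingerKernel (squareDispersion 1 0) μ U k k' := by
  rw [kohnLuttingerKernel, kohnLuttingerKernel, ← kl_ld4_rot_add, hχ]

/-- If `χ₀ ∘ rot = χ₀` then `Γ(f ∘ rot)(k) = (Γ f)(rot k)` for `μ ∈ (-4, 0)`. [folklore] -/
theorem kl_rp_kernel_integral_comp_rot
    (hχ : ∀ (μ : ℝ) (q : Momentum),
      lindhardFunction (squareDispersion 1 0) μ (rotMomentum q) = lindhardFunction (squareDispersion 1 0) μ q)
    {μ : ℝ} (hμ : μ ∈ Set.Ioo (-4 : ℝ) 0) (U : ℝ) (f : Momentum → ℝ) (k : Momentum) :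
    ∫ k', kohnLuttingerKernel (squareDispersion 1 0) μ U k k' * (f ∘ rotMomentum) k'
        ∂fermiCurveMeasure (squareDispersion 1 0) μ =
      ∫ k', kohnLuttingerKernel (squareDispersion 1 0) μ U (rotMomentum k) k' * f k'
        ∂fermiCurveMeasure (squareDispersion 1 0) μ := by
  have h : ∫ k', kohnLuttingerKernel (squareDispersion 1 0) μ U (rotMomentum k) (rotMomentum k') *
      f (rotMomentum k') ∂fermiCurveMeasure (squareDispersion 1 0) μ =
      ∫ k', kohnLuttingerKernel (squareDispersion 1 0) μ U (rotMomentum k) k' * f k'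
        ∂fermiCurveMeasure (squareDispersion 1 0) μ :=
    kl_rp_integral_comp_rot hμ (fun k' => kohnLuttingerKernel (squareDispersion 1 0) μ U (rotMomentum k) k' * f k')
  rw [← h]
  simp only [Function.comp_apply, kl_rp_kernel_rot hχ]

/-- If `χ₀ ∘ rot = χ₀` then the pairing form is `rot`-invariant for `μ ∈ (-4, 0)`:
`pairingForm (f ∘ rot) = pairingForm f`. [folklore] -/
theorem kl_rp_pairingForm_comp_rot
    (hχ : ∀ (μ : ℝ) (q : Momentum),
      lindhardFunction (squareDispersion 1 0) μ (rotMomentum q) = lindhardFunction (squareDispersion 1 0) μ q)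
    {μ : ℝ} (hμ : μ ∈ Set.Ioo (-4 : ℝ) 0) (U : ℝ) (f : Momentum → ℝ) :
    pairingForm (squareDispersion 1 0) μ U (f ∘ rotMomentum) = pairingForm (squareDispersion 1 0) μ U f := by
  rw [pairingForm, pairingForm,
    ← kl_rp_integral_comp_rot hμ (fun k => f k *
      ∫ k', kohnLuttingerKernel (squareDispersion 1 0) μ U k k' * f k' ∂fermiCurveMeasure (squareDispersion 1 0) μ)]
  congr 1
  funext k
  rw [kl_rp_kernel_integral_comp_rot hχ hμ U f k, Function.comp_apply]

/-! ### Orthogonality -/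

/-- For `μ ∈ (-4, 0)` an odd gap function is `σ_μ`-orthogonal to its rotate:
`∫ f (f ∘ rot) dσ_μ = 0` (`rot² = -id`). [folklore] -/
theorem kl_rp_integral_mul_comp_rot {μ : ℝ} (hμ : μ ∈ Set.Ioo (-4 : ℝ) 0) {f : Momentum → ℝ}
    (hodd : ∀ k, f (-k) = -f k) :
    ∫ k, f k * f (rotMomentum k) ∂fermiCurveMeasure (squareDispersion 1 0) μ = 0 := by
  have h : ∫ k, f (rotMomentum k) * f (rotMomentum (rotMomentum k)) ∂fermiCurveMeasure (squareDispersion 1 0) μ =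
      ∫ k, f k * f (rotMomentum k) ∂fermiCurveMeasure (squareDispersion 1 0) μ :=
    kl_rp_integral_comp_rot hμ (fun k => f k * f (rotMomentum k))
  simp only [CwKLChiralWindow.Negative.rot_rot, hodd, mul_neg, integral_neg] at h
  have h2 : ∫ k, f (rotMomentum k) * f k ∂fermiCurveMeasure (squareDispersion 1 0) μ =
      ∫ k, f k * f (rotMomentum k) ∂fermiCurveMeasure (squareDispersion 1 0) μ := by
    congr 1
    funext k
    ring
  linarith

/-! ### The stub -/

/-- **Rotation partner of an `E` state.** On the window levels `μ ∈ (-4,0)`, if `χ₀` is rotation invariant then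
for every `E` channel state `f` the rotate `f ∘ rot` is an `E` channel state, has the same pairing form (every
`U`), and is orthogonal to `f` (`f` odd, `rot² = -1`, `σ` rotation invariant). [folklore] -/
theorem stub_klRotPartner :
    (∀ (μ : ℝ) (q : Momentum),
      lindhardFunction (squareDispersion 1 0) μ (rotMomentum q) = lindhardFunction (squareDispersion 1 0) μ q) →
    ∀ μ ∈ Set.Ioo (-4 : ℝ) 0, ∀ f : Momentum → ℝ,
      IsChannelState (squareDispersion 1 0) μ D4Irrep.E f →
      IsChannelState (squareDispersion 1 0) μ D4Irrep.E (f ∘ rotMomentum) ∧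
      (∀ U : ℝ, pairingForm (squareDispersion 1 0) μ U (f ∘ rotMomentum) = pairingForm (squareDispersion 1 0) μ U f) ∧
      ∫ k, f k * f (rotMomentum k) ∂fermiCurveMeasure (squareDispersion 1 0) μ = 0 := by
  intro hχ μ hμ f hf
  exact ⟨kl_rp_isChannelState_comp_rot hμ hf, fun U => kl_rp_pairingForm_comp_rot hχ hμ U f,
    kl_rp_integral_mul_comp_rot hμ ((inChannel_E_iff_odd f).1 hf.2.2)⟩

end Summit.HubbardSuperconductivity.HubbardSuperconductivity.Theorems

end
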